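import Mathlib.Probability.Independence.Integration
import Mathlib.Probability.Independence.InfinitePi

/-!
# Line `telescoped-coding` / `smallfield-polymer-coder` (crux `IR`, stmt-QuantumFields-19354): independence of cylinder
# observables of a countable product (sequence-noise alphabet)

Route `BalabanLadder`, crux `IR`, coding lines of ideator ym-ir-idea-4 (skeletons `Cruxes/IR/Lines/telescoped_coding.lean`
v2 and `Cruxes/IR/Lines/smallfield_polymer_coder.lean`, engine hypothesis E = `stub_codedClustering` in the SEQUENCE
alphabet `seqNoise = Measure.infinitePi`), pooled prover `ym-ir-line-bsf-p1` (director-ym R366).  The one probabilistic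
tool the sequence-alphabet engine needs beyond the finite-product file `HaarCodingIndependence`:

* `integral_mul_eq_of_dependsOn_disjoint_infinitePi` — on a product `Π i, X` of copies of a probability measure over an
  ARBITRARY index type (Mathlib `Measure.infinitePi`), two bounded measurable observables depending on DISJOINT (possibly
  infinite) sets of coordinates are uncorrelated: `∫ f g = ∫ f · ∫ g`.  Route: coordinates are independent
  (`iIndepFun_infinitePi`), σ-algebras generated by disjoint blocks of coordinates are independent
  (`indep_iSup_of_disjoint`), and an observable depending only on a block is measurable for that block's σ-algebra
  (`measurable_blockSigma_of_dependsOn`, factoring through restriction/extension).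

Honest framing: plumbing; nothing here bears on the Yang–Mills mass gap (Clay).  R4 of the ladder closes only the
conditional finite-𝕋⁴ rung `BalabanLadder.UV`.
Refs: folklore; Y. Spinka, Ann. Probab. 48 (2020); line card `Cruxes/IR/Lines/telescoped_coding.md`.
-/

set_option autoImplicit false

noncomputable section

open MeasureTheory ProbabilityTheory Function

namespace Summit.QuantumFields.YangMills.Cruxes.IR.HaarCodingEngine

section InfinitePi

variable {ι : Type*} {X : Type*} [MeasurableSpace X] (μ : Measure X) [IsProbabilityMeasure μ]

/-- The σ-algebra generated by the coordinates in `S` (a plain definition, NOT an instance). -/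
@[reducible] def blockSigma (X : Type*) [MeasurableSpace X] (S : Set ι) : MeasurableSpace (ι → X) :=
  ⨆ j ∈ S, MeasurableSpace.comap (fun a : ι → X => a j) (inferInstance : MeasurableSpace X)

omit [IsProbabilityMeasure μ] in
/-- Each coordinate in `S` is measurable for the block σ-algebra. -/
theorem measurable_eval_blockSigma (S : Set ι) {i : ι} (hi : i ∈ S) :
    Measurable[blockSigma (ι := ι) X S] fun a : ι → X => a i := by
  refine Measurable.of_comap_le ?_
  exact le_iSup₂ (f := fun j (_ : j ∈ S) => MeasurableSpace.comap (fun a : ι → X => a j)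
    (inferInstance : MeasurableSpace X)) i hi

omit [IsProbabilityMeasure μ] in
/-- The block σ-algebra is coarser than the product σ-algebra. -/
theorem blockSigma_le (S : Set ι) : blockSigma (ι := ι) X S ≤ (inferInstance : MeasurableSpace (ι → X)) :=
  iSup₂_le fun j _ => (measurable_pi_apply j).comap_le

omit [IsProbabilityMeasure μ] in
/-- **An observable depending only on the coordinates in `S` is measurable for the σ-algebra generated by those
coordinates** (factor through restriction to `S` and extension by a fixed background). -/
theorem measurable_blockSigma_of_dependsOn {f : (ι → X) → ℝ} (hfm : Measurable f) {S : Set ι}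
    (hf : DependsOn f S) (x₀ : ι → X) : Measurable[blockSigma (ι := ι) X S] f := by
  classical
  -- restriction to `S` is block-measurable, extension is measurable, `f = (f ∘ ext) ∘ restr`
  have hrestr_m : Measurable[blockSigma (ι := ι) X S] fun (a : ι → X) (i : S) => a i :=
    @measurable_pi_lambda (ι → X) S (fun _ => X) (blockSigma (ι := ι) X S) _ _
      fun i => measurable_eval_blockSigma (X := X) S i.2
  have hext_m : Measurable fun (z : S → X) (i : ι) => if h : i ∈ S then z ⟨i, h⟩ else x₀ i := by
    refine measurable_pi_lambda _ fun i => ?_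
    by_cases h : i ∈ S
    · simp only [h, dite_true]; exact measurable_pi_apply _
    · simp only [h, dite_false]; exact measurable_const
  have hfact : f = (f ∘ fun (z : S → X) (i : ι) => if h : i ∈ S then z ⟨i, h⟩ else x₀ i) ∘
      fun (a : ι → X) (i : S) => a i := by
    funext a
    simp only [comp_apply]
    apply hf
    intro i hi
    simp [hi]
  rw [hfact]
  exact (hfm.comp hext_m).comp hrestr_m

/-- **Observables of disjoint coordinate blocks of a countable product are uncorrelated.**  On `Π i, X` with
`Measure.infinitePi (fun _ => μ)`, `μ` a probability measure: if `f` depends only on the coordinates in `S`, `g` only on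
those in `T`, `S ∩ T = ∅`, both measurable (and real-valued), then `∫ f g = (∫ f)(∫ g)`. -/
theorem integral_mul_eq_of_dependsOn_disjoint_infinitePi {f g : (ι → X) → ℝ} (hfm : Measurable f)
    (hgm : Measurable g) {S T : Set ι} (hf : DependsOn f S) (hg : DependsOn g T) (hST : Disjoint S T) :
    ∫ a, f a * g a ∂(Measure.infinitePi fun _ : ι => μ) =
      (∫ a, f a ∂(Measure.infinitePi fun _ : ι => μ)) * ∫ a, g a ∂(Measure.infinitePi fun _ : ι => μ) := by
  classical
  obtain ⟨x₀⟩ : Nonempty (ι → X) := by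
    haveI : Nonempty X := MeasureTheory.nonempty_of_isProbabilityMeasure μ
    exact ⟨fun _ => Classical.arbitrary X⟩
  -- coordinates are independent
  have hind : iIndepFun (fun (i : ι) (a : ι → X) => a i) (Measure.infinitePi fun _ : ι => μ) :=
    iIndepFun_infinitePi (P := fun _ : ι => μ) (X := fun _ : ι => (id : X → X)) fun _ => measurable_id
  have hind' := (iIndepFun_iff_iIndep (fun _ : ι => (inferInstance : MeasurableSpace X))
    (fun (i : ι) (a : ι → X) => a i) _).1 hind
  -- blocks of coordinates are independent
  have hblocks : Indep (blockSigma (ι := ι) X S) (blockSigma (ι := ι) X T) (Measure.infinitePi fun _ : ι => μ) :=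
    indep_iSup_of_disjoint (fun i => (measurable_pi_apply i).comap_le) hind' hST
  -- `f`, `g` are block-measurable
  have hfS := measurable_blockSigma_of_dependsOn (X := X) hfm hf x₀
  have hgT := measurable_blockSigma_of_dependsOn (X := X) hgm hg x₀
  have hfg : IndepFun f g (Measure.infinitePi fun _ : ι => μ) := by
    rw [IndepFun_iff_Indep]
    exact indep_of_indep_of_le_right (indep_of_indep_of_le_left hblocks hfS.comap_le) hgT.comap_le
  have h := hfg.integral_mul_eq_mul_integral hfm.aestronglyMeasurable hgm.aestronglyMeasurable
  simpa using h

end InfinitePi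

end Summit.QuantumFields.YangMills.Cruxes.IR.HaarCodingEngine

end
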